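import Mathlib
import Summits.MatrixMultiplication.MatrixMultiplication.Theorems.HiddenToeplitzCornersHiddenCornerLemmaRRankOnePencil
import Summits.MatrixMultiplication.MatrixMultiplication.Theorems.HiddenToeplitzCornersHiddenCornerLemmaRHConst
import Summits.MatrixMultiplication.MatrixMultiplication.Theorems.HiddenToeplitzCornersHiddenCornerLemmaRGConstD1

/-!
# Hidden-corner lemma at displacement rank `d = 1`: in fact `r ≤ 1`

Support file for crux item `stmt-MatrixMultiplication-10752`
(`Summit.MatrixMultiplication.MatrixMultiplication.Theses.HiddenToeplitzCorners.HiddenCornerLemmaR`).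

`hclR_d_one`: a pencil `T(X) = Σ X a b • T a b` whose Stein displacements `T(X) − Z T(X) Zᵀ` all have
rank `≤ 1`, hiding `T(X) E = F X` with `rank E = rank F = r`, and nonsingular somewhere, has `r ≤ 1`
(so the crux bound `r ≤ 2d` holds at `d = 1` with room).  Proof: the displacement space is a linear
space of rank-`≤ 1` matrices, hence (`hclR_rank_le_one_pencil_dichotomy`) of column type
`u ⊗ v a b` — settled by the valuation argument `hclR_gconst_d_one` — or of row type `u a b ⊗ w` —
the H-constant class with one generator, settled by `hclR_hconst_bound`.
-/

set_option linter.dupNamespace false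

namespace Summit.MatrixMultiplication.MatrixMultiplication.Theorems

open Matrix BigOperators

/-- **The hidden-corner lemma at `d = 1` (sharp form `r ≤ 1`).** -/
theorem hclR_d_one (r N : ℕ) (T : Fin r → Fin r → Matrix (Fin N) (Fin N) ℂ)
    (E F : Matrix (Fin N) (Fin r) ℂ) (hE : E.rank = r) (hF : F.rank = r)
    (hcorner : ∀ X : Matrix (Fin r) (Fin r) ℂ, (∑ a : Fin r, ∑ b : Fin r, X a b • T a b) * E = F * X)
    (hdisp : ∀ X : Matrix (Fin r) (Fin r) ℂ, ((∑ a : Fin r, ∑ b : Fin r, X a b • T a b) -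
        (Matrix.of fun i j : Fin N => if (i : ℕ) = (j : ℕ) + 1 then (1 : ℂ) else 0) *
        (∑ a : Fin r, ∑ b : Fin r, X a b • T a b) *
        (Matrix.of fun i j : Fin N => if (i : ℕ) = (j : ℕ) + 1 then (1 : ℂ) else 0)ᵀ).rank ≤ 1)
    (hns : ∃ X₀ : Matrix (Fin r) (Fin r) ℂ, (∑ a : Fin r, ∑ b : Fin r, X₀ a b • T a b).det ≠ 0) :
    r ≤ 1 := by
  set Z := (Matrix.of fun i j : Fin N => if (i : ℕ) = (j : ℕ) + 1 then (1 : ℂ) else 0) with hZ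
  -- the displacement pencil
  let D : Fin r × Fin r → Matrix (Fin N) (Fin N) ℂ := fun ab => T ab.1 ab.2 - Z * T ab.1 ab.2 * Zᵀ
  have hlin : ∀ c : Fin r × Fin r → ℂ, (∑ i, c i • D i) =
      (∑ a : Fin r, ∑ b : Fin r, (fun a b => c (a, b)) a b • T a b) -
        Z * (∑ a : Fin r, ∑ b : Fin r, (fun a b => c (a, b)) a b • T a b) * Zᵀ := by
    intro c
    simp only [D, smul_sub, Finset.sum_sub_distrib, Finset.mul_sum, Finset.sum_mul, Matrix.mul_smul,
      Matrix.smul_mul]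
    rw [← Finset.sum_product' (f := fun a b => c (a, b) • T a b),
      ← Finset.sum_product' (f := fun a b => c (a, b) • (Z * T a b * Zᵀ))]
    simp [Finset.univ_product_univ]
  have hrank : ∀ c : Fin r × Fin r → ℂ, (∑ i, c i • D i).rank ≤ 1 := by
    intro c; rw [hlin c]; exact hdisp _
  rcases hclR_rank_le_one_pencil_dichotomy D hrank with ⟨u, hu⟩ | ⟨w, hw⟩
  · -- column type: G-constant class with one generator
    choose v hv using hu
    exact hclR_gconst_d_one r N T E F hE hF u (fun a b => v (a, b)) (fun a b => hv (a, b)) hcorner hns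
  · -- row type: H-constant class with one generator
    choose u hu using hw
    rcases Nat.eq_zero_or_pos r with h0 | hpos
    · omega
    have hFne : F ≠ 0 := by
      intro h; rw [h, Matrix.rank_zero] at hF; omega
    refine hclR_hconst_bound r N 1 T E F (Matrix.of fun i (_ : Fin 1) => w i)
      (fun a b => Matrix.of fun i (_ : Fin 1) => u (a, b) i) hFne hcorner ?_
    intro a b
    have := hu (a, b)
    simp only [D] at this
    rw [this]
    ext i j
    simp [Matrix.vecMulVec_apply, Matrix.mul_apply]

end Summit.MatrixMultiplication.MatrixMultiplication.Theorems
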